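import Mathlib.MeasureTheory.Measure.Tight
import Mathlib.Analysis.SpecialFunctions.Pow.Real
import Mathlib.Analysis.SpecificLimits.Basic
import Literature.Probability.RandomPlanarGeometry.CurveTortuosity
import HarnessLib

/-!
# Tightness of random curves from power bounds on multiple shell crossings (Aizenman–Burchard)

Trunk `Stoch` (topic `Probability/RandomPlanarGeometry`). The probabilistic half of
M. Aizenman, A. Burchard, *Hölder regularity and dimension bounds for random curves*, Duke
Math. J. 99 (1999) 419–453, for a **single random curve per scale**: Theorems 1.1–1.2 with
Lemma 3.1, in the tortuosity formulation (AB99 §3.a, eq. (3.5)–(3.8)) and with the compactness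
criterion Lemma 4.1 in place of the Hölder reparametrisation (the deterministic ingredients are
in `CurveTortuosity.lean`).

`isTightMeasureSet_of_traversalBounds`: let `X_δ : Ω_δ → Curve E`, `δ ∈ T ⊆ (0, 1]`, be
random curves in a compact `Λ` (with covering numbers `N(Λ, ρ) ≤ C ρ^{-d}`) of a complete
metric space `E`, and `k : E → ℝ → ℝ → ℕ` a threshold. Assume
* **(H0, short-distance cutoff)** for `δ ∈ T`, almost surely `X_δ ⊆ Λ` and no shell
  `D(x; ρ, R)` of inner radius `ρ ≤ δ` is traversed by `k x ρ R` separate segments of `X_δ`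
  (AB99 §1.a: the curves are polygonal paths of step `≍ δ`);
* **(H1, AB99 (1.3))** for `δ ∈ T` and `δ ≤ ρ < R ≤ 1`,
  `P_δ(D(x; ρ, R) is traversed by k x ρ R separate segments of X_δ) ≤ K (ρ / R)^λ`, with
  `λ > d`.
Then the laws of the classes of `X_δ` in `CurveClass E`, `δ ∈ T`, form a tight set of
measures. AB99 assume (1.3) for all `k` with a constant threshold and `λ(k) → ∞` (hypothesis
H1) and treat whole configurations of curves; for one curve, one `k` with `λ > d` suffices
(AB99 Remark (iii) after Thm 1.1 and the covering bound `N(C, ℓ) ≤ N(Λ, ℓ)`), and letting the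
threshold depend on the shell costs nothing in the proof (the union bound of Lemma 3.1 only uses
the probabilities, the greedy bound (2.22) only the per-ball counts) — this is the form needed for
interfaces in a domain, whose boundary forces deterministic crossings near the marked points.

Proof (AB99 §3.a and §4): with `ε = (d + 1)/(λ - d)`, scales `ℓ_n = 2^{-n}`, inner radii
`ρ_n = ℓ_n^{1+ε}/8` and `ρ_n`-nets `S_n` of `Λ`, the event that some shell
`D(y; ρ_n, ℓ_n/2 - ρ_n)`, `y ∈ S_n`, `n ≥ n₀`, is traversed `k` times has probability
`≤ ∑_{n ≥ n₀} #S_n · K (8ρ_n/3ℓ_n)^λ ≤ 2 C K 8^d 2^{-n₀}` (Lemma 3.1; below the cutoff the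
events are null by (H0)); off this event the greedy bound gives `M(X_δ, ℓ_n) ≤ ∑_{y ∈ S_n} k`
for all `n ≥ n₀` (eq. (2.22), (3.6)), a uniform tortuosity bound, hence membership in a fixed
compact set of `CurveClass E` (Lemma 4.1). No measurability of `X_δ` is needed: outer measures
are subadditive, and a non-measurable `X_δ` has the junk law `0`.

Also: `exists_finset_card_le_cover_closedBall` — covering numbers of discs in `ℂ` (`d = 2`), the
input for planar lattice interfaces.
-/

open Set Filter Topology Metric MeasureTheory
open scoped unitInterval ENNReal

noncomputable section

namespace Literature.Probability.RandomPlanarGeometry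

variable {E : Type*} [PseudoMetricSpace E]

/-- **Aizenman–Burchard tightness criterion** (Duke Math. J. 99 (1999), Thms 1.1–1.2 with
Lemma 3.1, single-curve form with a shell-dependent threshold; see the module docstring for the
precise hypotheses (H0), (H1) and the proof). For random curves `X_δ`, `δ ∈ T ⊆ (0, 1]`, in a
compact `Λ` with covering numbers `≤ C ρ^{-d}` of a complete metric space: if almost surely no
shell of inner radius `≤ δ` is traversed `k x ρ R` times, and for `δ ≤ ρ < R ≤ 1` the
probability of `k x ρ R` separate traversals of `D(x; ρ, R)` is `≤ K (ρ/R)^λ` with `λ > d`, then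
the laws of `CurveClass.mk ∘ X_δ`, `δ ∈ T`, form a tight set of measures on `CurveClass E`.
[cite: AizenmanBurchardDuke1999, Thms 1.1-1.2 and Lemma 3.1] -/
theorem isTightMeasureSet_of_traversalBounds [CompleteSpace E]
    {Λ : Set E} (hΛ : IsCompact Λ) {C d : ℝ} (hd : 0 ≤ d)
    (hcov : ∀ ρ : ℝ, 0 < ρ → ρ ≤ 1 →
      ∃ S : Finset E, (S.card : ℝ) ≤ C * ρ ^ (-d) ∧ Λ ⊆ ⋃ y ∈ S, closedBall y ρ)
    {Ω : ℝ → Type*} [∀ δ, MeasurableSpace (Ω δ)] (P : ∀ δ, Measure (Ω δ))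
    (X : ∀ δ, Ω δ → Curve E) (k : E → ℝ → ℝ → ℕ) {K lam : ℝ} (hK : 0 ≤ K) (hlam : d < lam)
    {T : Set ℝ} (hT : T ⊆ Set.Ioc 0 1)
    (h0 : ∀ δ ∈ T, ∀ᵐ ω ∂P δ, (X δ ω).range ⊆ Λ ∧
      ∀ (x : E) (ρ R : ℝ), 0 < ρ → ρ ≤ δ → ρ < R → ¬ (X δ ω).HasTraversals (k x ρ R) x ρ R)
    (h1 : ∀ δ ∈ T, ∀ (x : E) (ρ R : ℝ), δ ≤ ρ → ρ < R → R ≤ 1 →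
      P δ {ω | (X δ ω).HasTraversals (k x ρ R) x ρ R} ≤ ENNReal.ofReal (K * (ρ / R) ^ lam)) :
    IsTightMeasureSet ((fun δ ↦ (P δ).map (CurveClass.mk ∘ X δ)) '' T) := by
  classical
  rw [isTightMeasureSet_iff_exists_isCompact_measure_compl_le]
  intro ε hε
  /- parameters -/
  have hlam0 : 0 < lam := hd.trans_lt hlam
  have hC : 0 ≤ C := by
    obtain ⟨S, hS, -⟩ := hcov 1 one_pos le_rfl
    have : (0 : ℝ) ≤ S.card := Nat.cast_nonneg _
    simpa using this.trans hS
  set e : ℝ := (d + 1) / (lam - d) with he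
  have he0 : 0 < e := div_pos (by linarith) (by linarith)
  have hθ : (1 + e) * (-d) + e * lam = 1 := by
    have hne : lam - d ≠ 0 := by linarith
    rw [he]
    field_simp
    ring
  /- scales -/
  set ℓ : ℕ → ℝ := fun n ↦ (1 / 2 : ℝ) ^ n with hℓ
  have hℓpos : ∀ n, 0 < ℓ n := fun n ↦ by positivity
  have hℓle : ∀ n, ℓ n ≤ 1 := fun n ↦ pow_le_one₀ (by norm_num) (by norm_num)
  set ρ : ℕ → ℝ := fun n ↦ ℓ n ^ (1 + e) * (1 / 8) with hρ
  have hρpos : ∀ n, 0 < ρ n := fun n ↦ by positivity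
  have hρle : ∀ n, ρ n ≤ ℓ n / 8 := fun n ↦ by
    have : ℓ n ^ (1 + e) ≤ ℓ n ^ (1 : ℝ) :=
      Real.rpow_le_rpow_of_exponent_ge (hℓpos n) (hℓle n) (by linarith)
    rw [Real.rpow_one] at this
    simp only [hρ]
    linarith
  have hρ1 : ∀ n, ρ n ≤ 1 := fun n ↦ by linarith [hρle n, hℓle n]
  set R : ℕ → ℝ := fun n ↦ ℓ n / 2 - ρ n with hR
  have hRge : ∀ n, 3 * ℓ n / 8 ≤ R n := fun n ↦ by simp only [hR]; linarith [hρle n]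
  have hRpos : ∀ n, 0 < R n := fun n ↦ by linarith [hRge n, hℓpos n]
  have hρR : ∀ n, ρ n < R n := fun n ↦ by linarith [hRge n, hρle n, hℓpos n]
  have hR1 : ∀ n, R n ≤ 1 := fun n ↦ by
    simp only [hR]; linarith [hℓle n, hρpos n]
  have h2ρ : ∀ n, 2 * ρ n < ℓ n / 2 := fun n ↦ by linarith [hρle n, hℓpos n]
  -- the probability bound at scale `n`: `K (ρ/R)^λ ≤ K ℓ^{ελ} / ...`; we use `(ρ/R)^λ ≤ (ℓ^{1+e}/ℓ)^λ`
  have hratio : ∀ n, (ρ n / R n) ^ lam ≤ ℓ n ^ (e * lam) := fun n ↦ by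
    have h1 : ρ n / R n ≤ ℓ n ^ e := by
      rw [div_le_iff₀ (hRpos n)]
      have : ℓ n ^ (1 + e) = ℓ n * ℓ n ^ e := by
        rw [Real.rpow_add (hℓpos n), Real.rpow_one]
      calc ρ n = ℓ n ^ (1 + e) * (1 / 8) := rfl
        _ ≤ ℓ n ^ (1 + e) * (3 / 8) := by gcongr; norm_num
        _ = ℓ n ^ e * (3 * ℓ n / 8) := by rw [this]; ring
        _ ≤ ℓ n ^ e * R n := by gcongr; exact hRge n
    calc (ρ n / R n) ^ lam ≤ (ℓ n ^ e) ^ lam :=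
          Real.rpow_le_rpow (div_nonneg (hρpos n).le (hRpos n).le) h1 hlam0.le
      _ = ℓ n ^ (e * lam) := by rw [← Real.rpow_mul (hℓpos n).le]
  /- nets -/
  choose S hScard hScov using fun n ↦ hcov (ρ n) (hρpos n) (hρ1 n)
  -- `#S_n · K ℓ_n^{ελ} ≤ B ℓ_n` with `B = C K 8^d`
  set B : ℝ := C * K * (8 : ℝ) ^ d with hB
  have hB0 : 0 ≤ B := by positivity
  have hkey : ∀ n, (S n).card * (K * ℓ n ^ (e * lam)) ≤ B * ℓ n := fun n ↦ by
    have hρd : ρ n ^ (-d) = ℓ n ^ ((1 + e) * (-d)) * (8 : ℝ) ^ d := by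
      simp only [hρ]
      rw [Real.mul_rpow (by positivity) (by norm_num), ← Real.rpow_mul (hℓpos n).le,
        Real.rpow_neg (by norm_num), Real.div_rpow zero_le_one (by norm_num), Real.one_rpow]
      field_simp
    have hprod : ρ n ^ (-d) * ℓ n ^ (e * lam) = (8 : ℝ) ^ d * ℓ n := by
      rw [hρd, mul_comm _ ((8 : ℝ) ^ d), mul_assoc, ← Real.rpow_add (hℓpos n), hθ, Real.rpow_one]
    calc (S n).card * (K * ℓ n ^ (e * lam))
        ≤ C * ρ n ^ (-d) * (K * ℓ n ^ (e * lam)) :=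
          mul_le_mul_of_nonneg_right (hScard n) (mul_nonneg hK (Real.rpow_nonneg (hℓpos n).le _))
      _ = C * K * (ρ n ^ (-d) * ℓ n ^ (e * lam)) := by ring
      _ = B * ℓ n := by rw [hprod, hB]; ring
  /- choice of `n₀` -/
  obtain ⟨n₀, hn₀⟩ : ∃ n₀ : ℕ, ENNReal.ofReal (2 * B * ℓ n₀) ≤ ε := by
    rcases eq_or_ne ε ⊤ with rfl | hεtop
    · exact ⟨0, le_top⟩
    have hεr : 0 < ε.toReal := ENNReal.toReal_pos hε.ne' hεtop
    rcases eq_or_lt_of_le hB0 with hB00 | hBpos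
    · exact ⟨0, by simp [← hB00]⟩
    obtain ⟨n₀, hn₀⟩ := exists_pow_lt_of_lt_one (div_pos hεr (by positivity : (0 : ℝ) < 2 * B))
      (by norm_num : (1 / 2 : ℝ) < 1)
    refine ⟨n₀, ?_⟩
    rw [← ENNReal.ofReal_toReal hεtop]
    refine ENNReal.ofReal_le_ofReal ?_
    have := (lt_div_iff₀ (by positivity : (0 : ℝ) < 2 * B)).1 hn₀
    simp only [hℓ]
    linarith
  /- the compact set: uniform tortuosity bounds at the scales `ℓ n`, `n ≥ n₀` -/
  set Φ : {n : ℕ // n₀ ≤ n} → ℕ := fun i ↦ ∑ y ∈ S i.1, k y (ρ i.1) (R i.1) with hΦ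
  set 𝒦 : Set (Curve E) :=
    {γ | γ.range ⊆ Λ ∧ ∀ i : {n : ℕ // n₀ ≤ n}, γ.tortuosity (ℓ i.1) ≤ Φ i} with h𝒦
  have hLsmall : ∀ η > 0, ∃ i : {n : ℕ // n₀ ≤ n}, 0 < ℓ i.1 ∧ ℓ i.1 ≤ η := by
    intro η hη
    obtain ⟨m, hm⟩ := exists_pow_lt_of_lt_one hη (by norm_num : (1 / 2 : ℝ) < 1)
    refine ⟨⟨max n₀ m, le_max_left _ _⟩, hℓpos _, ?_⟩
    calc ℓ (max n₀ m) ≤ ℓ m :=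
          pow_le_pow_of_le_one (by norm_num) (by norm_num) (le_max_right _ _)
      _ ≤ η := hm.le
  have h𝒦c : IsCompact (closure (CurveClass.mk '' 𝒦)) := by
    -- (elaborated without the expected type first: unifying the statement of the compactness
    -- lemma against the `set` abbreviations head-on is pathologically slow)
    have h := CurveClass.isCompact_closure_image_mk_of_tortuosity_le hΛ
      (fun i : {n : ℕ // n₀ ≤ n} ↦ ℓ i.1) Φ hLsmall
    exact h
  refine ⟨closure (CurveClass.mk '' 𝒦), h𝒦c, ?_⟩
  /- the estimate for each law -/
  rintro μ ⟨δ, hδT, rfl⟩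
  obtain ⟨hδ0, hδ1⟩ := hT hδT
  -- the good event of (H0) and the bad events at scale `n`
  set G₀ : Set (Ω δ) := {ω | (X δ ω).range ⊆ Λ ∧
    ∀ (x : E) (ρ R : ℝ), 0 < ρ → ρ ≤ δ → ρ < R → ¬ (X δ ω).HasTraversals (k x ρ R) x ρ R} with hG₀
  have hG₀null : P δ G₀ᶜ = 0 := by
    rw [hG₀, compl_setOf]
    exact ae_iff.1 (h0 δ hδT)
  set Bad : ℕ → Set (Ω δ) := fun n ↦
    ⋃ y ∈ S n, {ω | (X δ ω).HasTraversals (k y (ρ n) (R n)) y (ρ n) (R n)} with hBad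
  have hBadle : ∀ n, P δ (Bad n) ≤ ENNReal.ofReal (B * ℓ n) := by
    intro n
    rcases le_or_gt δ (ρ n) with hδρ | hρδ
    · -- above the cutoff: union bound and (H1)
      calc P δ (Bad n) ≤ ∑ y ∈ S n, P δ {ω | (X δ ω).HasTraversals (k y (ρ n) (R n)) y (ρ n) (R n)} :=
            measure_biUnion_finset_le _ _
        _ ≤ ∑ y ∈ S n, ENNReal.ofReal (K * ℓ n ^ (e * lam)) := by
            refine Finset.sum_le_sum fun y _ ↦ (h1 δ hδT y (ρ n) (R n) hδρ (hρR n) (hR1 n)).trans ?_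
            exact ENNReal.ofReal_le_ofReal (mul_le_mul_of_nonneg_left (hratio n) hK)
        _ = ENNReal.ofReal ((S n).card * (K * ℓ n ^ (e * lam))) := by
            rw [Finset.sum_const, nsmul_eq_mul, ENNReal.ofReal_mul (Nat.cast_nonneg _),
              ENNReal.ofReal_natCast]
        _ ≤ ENNReal.ofReal (B * ℓ n) := ENNReal.ofReal_le_ofReal (hkey n)
    · -- below the cutoff: the bad event is null by (H0)
      have hsub : Bad n ⊆ G₀ᶜ := by
        intro ω hω hωG
        simp only [hBad, mem_iUnion, mem_setOf_eq, exists_prop] at hω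
        obtain ⟨y, -, hy⟩ := hω
        exact hωG.2 y (ρ n) (R n) (hρpos n) hρδ.le (hρR n) hy
      calc P δ (Bad n) ≤ P δ G₀ᶜ := measure_mono hsub
        _ = 0 := hG₀null
        _ ≤ _ := bot_le
  -- the tail union bound (AB99 Lemma 3.1)
  have hfun : (fun m : ℕ ↦ B * ℓ (n₀ + m)) = fun m ↦ B * (1 / 2 : ℝ) ^ n₀ * (1 / 2 : ℝ) ^ m := by
    funext m
    simp only [hℓ, pow_add]
    ring
  have htail : P δ (⋃ m : ℕ, Bad (n₀ + m)) ≤ ε := by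
    calc P δ (⋃ m : ℕ, Bad (n₀ + m)) ≤ ∑' m, P δ (Bad (n₀ + m)) := measure_iUnion_le _
      _ ≤ ∑' m : ℕ, ENNReal.ofReal (B * ℓ (n₀ + m)) := ENNReal.tsum_le_tsum fun m ↦ hBadle _
      _ = ENNReal.ofReal (∑' m : ℕ, B * ℓ (n₀ + m)) := by
          refine (ENNReal.ofReal_tsum_of_nonneg (fun m ↦ by positivity) ?_).symm
          rw [hfun]
          exact summable_geometric_two.mul_left _
      _ = ENNReal.ofReal (2 * B * ℓ n₀) := by
          congr 1
          rw [hfun, tsum_mul_left, tsum_geometric_two]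
          simp only [hℓ]
          ring
      _ ≤ ε := hn₀
  -- off the bad events the curve has the uniform tortuosity bounds
  have hgood : ∀ ω, ω ∈ G₀ → ω ∉ (⋃ m : ℕ, Bad (n₀ + m)) → X δ ω ∈ 𝒦 := by
    intro ω hω hωB
    refine ⟨hω.1, fun i ↦ ?_⟩
    obtain ⟨n, hn⟩ := i
    have hnotbad : ω ∉ Bad n := by
      intro h
      refine hωB (mem_iUnion.2 ⟨n - n₀, ?_⟩)
      rwa [Nat.add_sub_cancel' hn]
    have htrav : ∀ y ∈ S n, ¬ (X δ ω).HasTraversals (k y (ρ n) (R n)) y (ρ n) (ℓ n / 2 - ρ n) := by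
      intro y hy h
      exact hnotbad (mem_iUnion₂.2 ⟨y, hy, h⟩)
    have := Curve.tortuosity_le_of_cover (γ := X δ ω) (a := ℓ n / 2) (by positivity) (h2ρ n)
      (S n) (fun y ↦ k y (ρ n) (R n)) (hω.1.trans (hScov n)) htrav
    have h2 : 2 * (ℓ n / 2) = ℓ n := by ring
    rw [h2] at this
    exact this
  have hincl : (CurveClass.mk ∘ X δ) ⁻¹' (closure (CurveClass.mk '' 𝒦))ᶜ ⊆
      G₀ᶜ ∪ ⋃ m : ℕ, Bad (n₀ + m) := by
    intro ω hω
    by_contra hcon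
    simp only [mem_union, mem_compl_iff, not_or, not_not] at hcon
    have hω' : (CurveClass.mk ∘ X δ) ω ∉ closure (CurveClass.mk '' 𝒦) := hω
    exact hω' (subset_closure ⟨X δ ω, hgood ω hcon.1 hcon.2, rfl⟩)
  change ((P δ).map (CurveClass.mk ∘ X δ)) (closure (CurveClass.mk '' 𝒦))ᶜ ≤ ε
  by_cases hae : AEMeasurable (CurveClass.mk ∘ X δ) (P δ)
  · rw [Measure.map_apply_of_aemeasurable hae h𝒦c.isClosed.measurableSet.compl]
    calc P δ ((CurveClass.mk ∘ X δ) ⁻¹' (closure (CurveClass.mk '' 𝒦))ᶜ)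
        ≤ P δ (G₀ᶜ ∪ ⋃ m : ℕ, Bad (n₀ + m)) := measure_mono hincl
      _ ≤ P δ G₀ᶜ + P δ (⋃ m : ℕ, Bad (n₀ + m)) := measure_union_le _ _
      _ ≤ 0 + ε := add_le_add hG₀null.le htail
      _ = ε := zero_add _
  · rw [Measure.map_of_not_aemeasurable hae]
    simp

/-! ### Covering numbers of planar discs -/

/-- **Covering numbers of discs in the plane**: the closed disc of radius `r₀ ≥ 0` in `ℂ` is
covered, for every `0 < ρ ≤ 1`, by the closed `ρ`-balls about at most `9 (r₀ + 2)² ρ^{-2}`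
points (the points of the grid `ρℤ²` in a slightly larger square). This is the covering input
`N(Λ, ℓ) ≤ C ℓ^{-d}`, `d = 2`, of the tightness criterion for planar lattice interfaces
(Aizenman–Burchard 1999, §2.d (2.23): box-counting in `ℝ^d`). [cite: AizenmanBurchardDuke1999, §2.d (2.23)] -/
theorem exists_finset_card_le_cover_closedBall {r₀ : ℝ} (hr₀ : 0 ≤ r₀) (ρ : ℝ) (hρ : 0 < ρ)
    (hρ1 : ρ ≤ 1) :
    ∃ S : Finset ℂ, (S.card : ℝ) ≤ 9 * (r₀ + 2) ^ 2 * ρ ^ (-(2 : ℝ)) ∧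
      closedBall (0 : ℂ) r₀ ⊆ ⋃ y ∈ S, closedBall y ρ := by
  classical
  -- grid `{ρ (i, j) : |i|, |j| ≤ m}` with `m = ⌈r₀ / ρ⌉₊ + 1`
  set m : ℕ := ⌈r₀ / ρ⌉₊ + 1 with hm
  set box : Finset (ℤ × ℤ) := (Finset.Icc (-(m : ℤ)) m) ×ˢ (Finset.Icc (-(m : ℤ)) m) with hbox
  set g : ℤ × ℤ → ℂ := fun p ↦ ⟨ρ * p.1, ρ * p.2⟩ with hg
  refine ⟨box.image g, ?_, ?_⟩
  · -- cardinality
    have hcard : ((box.image g).card : ℝ) ≤ (2 * m + 1) ^ 2 := by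
      calc ((box.image g).card : ℝ) ≤ box.card := by exact_mod_cast Finset.card_image_le
        _ = (2 * m + 1) ^ 2 := by
            simp only [hbox, Finset.card_product, Int.card_Icc, sub_neg_eq_add]
            have : ((m : ℤ) + 1 + m).toNat = 2 * m + 1 := by omega
            rw [this]
            push_cast
            ring
    have hmle : (m : ℝ) ≤ (r₀ + 2) / ρ := by
      have h1 : (⌈r₀ / ρ⌉₊ : ℝ) < r₀ / ρ + 1 := Nat.ceil_lt_add_one (div_nonneg hr₀ hρ.le)
      have h2 : (1 : ℝ) ≤ 1 / ρ := by rw [le_div_iff₀ hρ]; linarith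
      calc (m : ℝ) = ⌈r₀ / ρ⌉₊ + 1 := by simp [hm]
        _ ≤ r₀ / ρ + 1 / ρ + 1 / ρ := by linarith
        _ = (r₀ + 2) / ρ := by ring
    have h2m : (2 * m + 1 : ℝ) ≤ 3 * ((r₀ + 2) / ρ) := by
      have h3 : (1 : ℝ) ≤ (r₀ + 2) / ρ := by
        rw [le_div_iff₀ hρ]; linarith
      linarith
    have hρ2 : ρ ^ (-(2 : ℝ)) = 1 / ρ ^ 2 := by
      rw [Real.rpow_neg hρ.le, Real.rpow_two, one_div]
    rw [hρ2]
    calc ((box.image g).card : ℝ) ≤ (2 * m + 1) ^ 2 := hcard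
      _ ≤ (3 * ((r₀ + 2) / ρ)) ^ 2 := by gcongr
      _ = 9 * (r₀ + 2) ^ 2 * (1 / ρ ^ 2) := by field_simp; norm_num
  · -- covering: round the coordinates to the nearest grid point
    intro z hz
    rw [mem_closedBall, dist_zero_right] at hz
    set i : ℤ := round (z.re / ρ) with hi
    set j : ℤ := round (z.im / ρ) with hj
    have hre : |z.re| ≤ r₀ := (Complex.abs_re_le_norm z).trans hz
    have him : |z.im| ≤ r₀ := (Complex.abs_im_le_norm z).trans hz
    have hbound : ∀ (x : ℝ), |x| ≤ r₀ → |(round (x / ρ) : ℝ)| ≤ m := by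
      intro x hx
      have h1 : |(round (x / ρ) : ℝ) - x / ρ| ≤ 1 / 2 := by
        rw [abs_sub_comm]; exact abs_sub_round (x / ρ)
      have h2 : |x / ρ| ≤ r₀ / ρ := by rw [abs_div, abs_of_pos hρ]; gcongr
      have h3 : (r₀ / ρ : ℝ) ≤ ⌈r₀ / ρ⌉₊ := Nat.le_ceil _
      have h4 : |(round (x / ρ) : ℝ)| ≤ |(round (x / ρ) : ℝ) - x / ρ| + |x / ρ| := by
        have := abs_add_le ((round (x / ρ) : ℝ) - x / ρ) (x / ρ)
        rwa [sub_add_cancel] at this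
      simp only [hm, Nat.cast_add, Nat.cast_one]
      linarith
    have hmem : (i, j) ∈ box := by
      simp only [hbox, Finset.mem_product, Finset.mem_Icc]
      have hi' := hbound z.re hre
      have hj' := hbound z.im him
      rw [← hi] at hi'
      rw [← hj] at hj'
      rw [← Int.cast_abs] at hi' hj'
      have hi'' : |i| ≤ (m : ℤ) := by exact_mod_cast hi'
      have hj'' : |j| ≤ (m : ℤ) := by exact_mod_cast hj'
      exact ⟨abs_le.1 hi'', abs_le.1 hj''⟩
    refine mem_iUnion₂.2 ⟨g (i, j), Finset.mem_image_of_mem g hmem, ?_⟩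
    rw [mem_closedBall, Complex.dist_eq]
    have hre' : |z.re - ρ * i| ≤ ρ / 2 := by
      have h1 := abs_sub_round (z.re / ρ)
      have : z.re - ρ * i = ρ * (z.re / ρ - round (z.re / ρ)) := by
        rw [hi]; field_simp
      rw [this, abs_mul, abs_of_pos hρ]
      calc ρ * |z.re / ρ - round (z.re / ρ)| ≤ ρ * (1 / 2) := by gcongr
        _ = ρ / 2 := by ring
    have him' : |z.im - ρ * j| ≤ ρ / 2 := by
      have h1 := abs_sub_round (z.im / ρ)
      have : z.im - ρ * j = ρ * (z.im / ρ - round (z.im / ρ)) := by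
        rw [hj]; field_simp
      rw [this, abs_mul, abs_of_pos hρ]
      calc ρ * |z.im / ρ - round (z.im / ρ)| ≤ ρ * (1 / 2) := by gcongr
        _ = ρ / 2 := by ring
    calc ‖z - g (i, j)‖ ≤ |(z - g (i, j)).re| + |(z - g (i, j)).im| := Complex.norm_le_abs_re_add_abs_im _
      _ = |z.re - ρ * i| + |z.im - ρ * j| := by simp [hg]
      _ ≤ ρ / 2 + ρ / 2 := add_le_add hre' him'
      _ = ρ := by ring

end Literature.Probability.RandomPlanarGeometry
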